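import Literature.NumberTheory.Automorphic.ResGLnKugaWigner
import Literature.NumberTheory.Automorphic.CuspidalPeterssonForm
import Literature.NumberTheory.Automorphic.AdelicGroupDataAutomorphicMeasureProofs
import HarnessLib

/-!
# Basic non-trivial cuspidal cohomology classes are represented by closed and coclosed cochains

Topic `NumberTheory/Automorphic`; namespace `Literature.NumberTheory.Automorphic.ConeDictionary`
(vocabulary of `ResGLnConeDictionary`, `ResGLnKugaHarmonic`, `ResGLnKugaWigner`).  Theorems only;
no definition, no named fact, no `sorry`.

Steps 0 + 2 of Borel's injectivity of cuspidal cohomology in the cone model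
(`ResGLnCuspidalCohomologyApex`, fact `Borel1983_coneClass_ne_zero`) FOR THE DATA OF THE FACT: a
clean cuspidal `π` (`W ≤ 𝒜₀`, `W' = ⊥`) of `GL_n(𝔸_K)`, `n ≠ 0`.  The positive Hermitian form on
`W` is the unitarily normalised Petersson product of `CuspidalPeterssonForm` (`UnitaryTwist.pet`,
for an automorphic measure, which exists: `AdelicGroupData.exists_isAutomorphicMeasure_gl_holds`),
along which the trace-zero Hermitian `x i` act skew-adjointly (`pet_lieDerivW_left` with
`ResGLnCartan.mixedTrace_trace_x`).  Hence (`d_eq_zero_and_coclosed_of_not_mem_coboundaries`):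

* **`d_eq_zero_and_coclosed_of_cuspidal`** — if the trace-form Casimir operators act by scalars
  on `W` and on `E_λ`, every basic cocycle of positive degree of `C^•(𝔤, K_∞; W ⊗ E_λ)` which is
  not a coboundary is closed and COCLOSED.

What then remains of Borel's proof is the analytic half: the regularization / de Rham comparison on
`Γ \ X⁺` producing a primitive of moderate growth (Step 3) and the energy argument
`ChevalleyEilenbergPairedPrimitive.eq_zero_of_pairedPrimitive` (Step 4).
[cite: BorelWallach2000, II §2.5, Prop. 3.1; I §5.3]

## References

* A. Borel, N. Wallach, *Continuous cohomology, discrete subgroups, and representations of reductive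
  groups*, 2nd ed. (2000), II §2.5, 3.1, I §5.3 (held). [BorelWallach2000]
* A. Borel, *Automorphic forms on SL₂(ℝ)* (1997), 11.12 (2). [Borel1997]
-/

noncomputable section

namespace Literature.NumberTheory.Automorphic

-- Mathlib idiom (as in `GKModules`): commutator bracket on matrix algebras and `Module.End`
attribute [local instance 100] LieRing.ofAssociativeRing

-- `Classical`: the place subtypes indexing `mixedSpace K` are `Fintype` classically (as in `AdelicGLnGlue`).
open scoped TensorProduct Classical _root_.Matrix
open _root_.NumberField _root_.NumberField.mixedEmbedding Literature.Algebra.Lie.ChevalleyEilenberg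

namespace ConeDictionary

variable {n : ℕ} {K : Type} [Field K] [NumberField K] {hcpt : isCompact_glFiniteIntegralLevel n K}
  (π : CuspidalAutomorphicRepData n K hcpt)
  (S : Finset {w : InfinitePlace K // w.IsReal}) (lam : (K →+* ℂ) → Fin n → ℤ)

/-- **Steps 0 + 2 of Borel's injectivity proof for a clean cuspidal `π` of `GL_n(𝔸_K)`, `n ≠ 0`**:
if the trace-form Casimir operators act on the cusp forms `W` and on `E_λ` by scalars, then every
basic cocycle `η ∈ Z^{q+1}` of `C^•(𝔤, K_∞; W ⊗ E_λ)` (`i_Z η = 0`) which is not a coboundary is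
closed and COCLOSED — `h η = 0` for the homotopy of `s = π ⊗ 1 - 1 ⊗ dE_λ` along the orthonormal
basis `x` of `𝔭₀`; the positive Hermitian form on `W` is the unitarily normalised Petersson product.
[cite: BorelWallach2000, II §2.5, Prop. 3.1; I §5.3] -/
theorem d_eq_zero_and_coclosed_of_cuspidal [NeZero n] (hW' : π.1.W' = ⊥) {c c' : ℂ}
    (hc : ∀ v : π.1.W, GKCasimir.op (AutomorphyDatum.gl n K hcpt).arch π.1.lieRepW (bD n K hcpt) (dD n K hcpt) v = c • v)
    (hc' : ∀ e : ResGLnCohomology.CoeffModule ℂ n K lam,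
      GKCasimir.op (AutomorphyDatum.gl n K hcpt).arch (σ𝔤S hcpt lam) (bD n K hcpt) (dD n K hcpt) e = c' • e)
    (q : ℕ) {η : Cochain π.1 lam (q + 1)} (hZ : η ∈ (gkComplexLS π.1 S lam).cocycles (q + 1))
    (hB : η ∉ (gkComplexLS π.1 S lam).coboundaries (q + 1))
    (hins : ins q (⟨1, trivial⟩ : (AutomorphyDatum.gl n K hcpt).arch.lie) η = 0) :
    d ℝ (𝔤D n K hcpt) (Carrier π.1 lam) (q + 1) η = 0 ∧
      casimirHomotopy (kugaS π.1 lam) (xD n K hcpt) (xD n K hcpt) q η = 0 := by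
  obtain ⟨μ, hμ⟩ := AdelicGroupData.exists_isAutomorphicMeasure_gl_holds n K
  obtain ⟨T⟩ := π.1.nonempty_unitaryTwist π.2 hW'
  exact d_eq_zero_and_coclosed_of_not_mem_coboundaries π.1 S lam (T.isPosForm_pet μ)
    (fun i v v' => T.pet_lieDerivW_left μ (xD n K hcpt i) (ResGLnCartan.mixedTrace_trace_x n K i) v v') hc hc' q hZ hB
    hins

end ConeDictionary

end Literature.NumberTheory.Automorphic

end
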